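import Literature.MathematicalPhysics.QuantumFieldTheory.Balaban1983to89.B9RWSums347DefiniteFaces
import Literature.MathematicalPhysics.QuantumFieldTheory.Balaban1983to89.B9RWSums346TwoGp

/-!
# `Balaban1983to89.B9RWSumsCompleteGeo9Y` — [B9] rows 13 ∕ 18 ∕ 19 of the N06 census AT THE GEOMETRY OF RECORD: Theorem 3.7 ∧
# Corollary 3.8 and Theorem 3.10 as whole printed leaves at the LITERAL all-blocks pins, composed from the operator-level inputs
# alone — every [4] Lemma-2.1 binder, every transport letter and every sign fact of the geometry DISCHARGED by name

T. Bałaban, *Propagators for lattice gauge theories in a background field*, Commun. Math. Phys. **99** (1985) 389–434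
[`Balaban1985BackgroundPropagators`, "B9"], Thm 3.7 (3.90) p. 409, Cor. 3.8 (3.94) p. 410, Thm 3.10 (3.107)–(3.108) pp. 415–416,
Thm 3.10 ⇒ Thm 3.3 p. 416: *"From (3.108) it follows that the expansion (3.107) is convergent in all norms in the inequalities
(3.42)–(3.47). This implies Theorem 3.3."*; [4] = T. Bałaban, *Propagators and renormalization transformations for lattice gauge
theories. II*, Commun. Math. Phys. **96** (1984) 223–250 [`Balaban1984PropagatorsII`], Lemma 2.1 (2.59)–(2.61) pp. 233–234.

statement-level skeleton of published theorems with citation tags; proofs where landed; nothing here is a claim about the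
Yang–Mills mass gap

THE POINT.  This seat's `B9RWSums346Two.thm310Printed_allPin_complete` ∕ `B9RWSums346TwoGp.thm37Printed_allPin_complete` are the
all-blocks leaves of rows 18–19 with NO displayed residual about the sums, over a generic family `geo : I → B9.Geometry`; they
take the sup-block leaf (`h310` ∕ `h37`), three Lemma-2.1 member-fact binders (`hfacts`, `h261`, `hF₁`), the symmetry of the
distance (`hdsymm`) and transport letters `R`, `H`.  The N06 knit instantiates them at def-Y's members `x : MemberY …` with the
geometry of record `geo9Y x` — where (2.60) ∕ (2.61) ∕ the metric facts are THEOREMS (n06-i `B9GeoLemma21KLevelV1`) and the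
Lemma-2.1 data are DEFINITE (the sibling `B9RWSums347DefiniteFaces`: door exponent `exp261`, `lemma21Pack_geo9Y`).  THIS FILE
composes, once and for all, the two leaves AT `geo9Y` from OPERATOR-LEVEL inputs only:

* `const37_nonneg_of_signs` — 0 ≦ `const37 …` from the signs of its letters.
* ★★ `thm37_cor38_complete_geo9Y` — ROWS 13 ∕ 19 (G′ side): `B9.Thm37Printed c35 geo9Y bg (fun x => E37AllOfOps (W38OfOps (𝔬 x)
  (rd x) 1 (H x) C δ) (𝔬 x) 1 (H x) C δ (K x) B₁ δ₁ Bβ Bε Bεβ) ∧ B9.Cor38Printed c35 geo9Y bg (same datum)` with the LITERAL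
  constants `C = const37 (exp261 geo9Y δ₀ α) δ₀ α ρ B₀ N N′ C_ℓ K_c`, `δ = (1 − 2α)δ₀`, from: the static data (`StaticOK`,
  `Sizes.Bounded`, `WalkReading.OK`, `Locality`), Corollary 3.6's packages for the local operators at (B₀, δ₀) (`h36 : Local342 ∧
  Identities`, `h36H : HolderLegs37 ∧ HolderV37 ∧ LapLegs37 ∧ InputLegs37 ∧ FactorsInput37 ∧ L2TwoLegs37 ∧ FactorsL2_37`),
  the co-readings of the kernel family `K x` (`CoRealizes`, `GlobReads`, `L2Reads` n = 0…5, `H1Reads`, `InputReads`), the transpose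
  letters, the support counts, the signs of the primitive constants, and the RELATIONS tying the all-blocks constants (B₁, δ₁, Bβ,
  Bε, Bεβ) to the definite derived ones (`holderConst` ∕ `lapConst` ∕ `twoConst` ∕ `inputConst44∕45` at the exponent `exp261 geo9Y δ₀
  α`, `c₁(exp261 geo9Y δ (1 − α_F))·(ℓ + 1)⁴`).  NO `h37`, NO `h261` ∕ `hfacts` ∕ `hF₁`, NO `hdsymm`, NO `R`, NO thresholds `M_L M_g M_F`,
  NO exponents `d d₁ d₁′`.
* ★★ `thm310_complete_geo9Y` — ROWS 18 ∕ 19 (G side): `B9.Thm310Printed c35 geo9Y bg (fun x => W310OfOps (𝔬 x) (rd x) (ConvAll3107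
  (𝔬 x) 1 (H x) C δ (K x) B₁ δ₁ Bβ Bε Bεβ))`, likewise, from `h36 : Local342G ∧ Factors389 ∧ Identities310`, `h36H : HolderLegs310 ∧
  FactorsHolder310 ∧ LapLegs310 ∧ InputLegs310 ∧ FactorsInput310 ∧ L2TwoLegs310 ∧ FactorsL2_310` and the same readings ∕ letters ∕
  relations — the binder shapes of n06-d's `…ObligationsPins8.t310_of_allPin_complete` ∕ `t37_of_allPin_complete`.

So the knit's rows 13, 18, 19 (`t37`, `c38`, `t310`, and `hsum` by `rwSumsYieldIneqs_allPins`) at def-Y's operator layer are ONE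
positional application each, with pins that are literal terms of the primitive constants.

HONEST SCOPE.  Kernel bookkeeping (two compositions); nothing of [B9] or [4] is asserted.  EVERY remaining hypothesis is about
the OPERATORS (Bałaban's G′_□, G_□, R_α(X), ∇_U, Δ_U, h_□, the probes and the input block norm — Corollary 3.6's blocks, (3.89),
the structure (3.88) ∕ (3.105), the Hölder ∕ Laplacian ∕ input ∕ L² legs, all POSITED schemas of printed shape exactly as in the
landed leaves), their READINGS into the kernel family, or a sign ∕ relation of constants; the geometry of record contributes no
hypothesis.  NOT a node discharge; count-neutral; one finite 𝕋⁴ programme at fixed ε — nothing continuum, nothing about the mass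
gap.  Cell `pub-ymgap` (HUMAN RULING D-0062), Track A node N06 [B9], N06-ASSIGNMENT v1 bundle F6 (rows 18–19), seat
`pub-ymgap-dag-n06-k` (gen 3), 2026-08-27.
-/

noncomputable section

namespace Literature.MathematicalPhysics.QuantumFieldTheory.Balaban1983to89.B9RWSumsCompleteGeo9Y

open Literature.MathematicalPhysics.QuantumFieldTheory.Balaban1983to89
open Finset B6RandomWalk B9Thm34Ext B9Thm37Whole B9Cor38Whole B9Thm310Whole B9RowSum261Faces B9RowSum261DefiniteFaces
open B9Ineq349Whole B9RWSums343to347Whole B9PinMembersKLevelV1 B9GeoLemma21KLevelV1 B9RWSums347DefiniteFaces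
open B9Thm37GlueCor36 B9Thm37Glue B9RWSums346Schur B9RWSums343Holder B9RWSums343HolderGp B9RWSums346Lap B9RWSums344Input
open B9RWSums344InputGp B9RWSums346Two B9RWSums346TwoGp B11SectG

/-- `0 ≤ const37 d δ₀ α ρ B₀ N N′ C_ℓ K` = 2B₀(N + N′e^{δ₀ρ}C_ℓK)c₁(α) from the signs B₀, N, N′, C_ℓ, K ≧ 0 (c₁ ≧ 0 always).
[cite: Balaban1985BackgroundPropagators, Thm 3.7 pp.409–410 (bookkeeping); Balaban1984PropagatorsII, Lemma 2.1 (2.61) p.234] -/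
theorem const37_nonneg_of_signs (d : ℕ) {δ₀ α ρ B₀ N N' Cℓ K : ℝ} (hB₀ : 0 ≤ B₀) (hN : 0 ≤ N) (hN' : 0 ≤ N')
    (hCℓ : 0 ≤ Cℓ) (hK : 0 ≤ K) : 0 ≤ const37 d δ₀ α ρ B₀ N N' Cℓ K := by
  simp only [const37]
  exact mul_nonneg (mul_nonneg (mul_nonneg (by norm_num) hB₀)
    (add_nonneg hN (mul_nonneg (mul_nonneg (mul_nonneg hN' (Real.exp_nonneg _)) hCℓ) hK))) (c1_nonneg d δ₀ α)

variable {d ℓ : ℕ} {hd : 1 ≤ d + 1} {hL : Odd (ℓ + 1) ∧ 1 < ℓ + 1} {b₀ b₁ : ℝ} {Mstar : ℕ}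
variable [∀ x : MemberY d ℓ hd hL b₀ b₁ Mstar, Fintype (geo9Y x).Site]
  [∀ x : MemberY d ℓ hd hL b₀ b₁ Mstar, DecidableEq (geo9Y x).Site]
variable {c35 : ℝ} {bg : MemberY d ℓ hd hL b₀ b₁ Mstar → B9.Backgrounds}

/-! ## Rows 13 ∕ 19, G′ side: Theorem 3.7 ∧ Corollary 3.8 at the literal all-blocks datum over the geometry of record -/

/-- ★★ **THEOREM 3.7 ∧ COROLLARY 3.8 AT THE LITERAL ALL-BLOCKS DATUM OVER def-Y's MEMBERS, FROM OPERATOR-LEVEL INPUTS ONLY.**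
With `C := const37 (exp261 geo9Y δ₀ α) δ₀ α ρ B₀ N N′ C_ℓ K_c`, `δ := (1 − 2α)δ₀` and the datum `E37AllOfOps (W38OfOps (𝔬 x) (rd x)
1 (H x) C δ) (𝔬 x) 1 (H x) C δ (K x) B₁ δ₁ Bβ Bε Bεβ` (p. 409 (3.90) with p. 410's *"convergent in all norms appearing in the
inequalities (3.42)–(3.47)"* READ as Theorem 3.1's typed blocks for the kernel family `K x`): the leaf `B9.Thm37Printed` AND the
leaf `B9.Cor38Printed` hold, given — the static data; Corollary 3.6's blocks for the G′_□ and the structure (3.88) (`h36`), the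
Hölder ∕ V-term ∕ Laplacian ∕ input ∕ two-sided L² legs (`h36H`) at (B₀, δ₀), all POSITED for M ≧ M₁, 0 < α₀,
O(1)Mα₀ ≦ a₁, (3.35); the co-readings of `K x`; the transpose letters; the support counts; the signs; and the relations of the
all-blocks constants (B₁, δ₁, Bβ, Bε, Bεβ) to the derived ones.  [4] Lemma 2.1 ((2.60), (2.61), the size condition), 1 ≦ L ≦ ℓ + 1,
η > 0 and d(a, b) = d(b, a) come from the record (`lemma21Pack_geo9Y`, `geo9Y_dist_symm`); the sup-block leaf from
`thm37_cor38_W38OfOps_exp261_geo9Y`; the rest is `B9RWSums346TwoGp.thm37Printed_allPin_complete`.  Nothing of print asserted; NOT a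
node discharge. [cite: Balaban1985BackgroundPropagators, Thm 3.7 (3.90) pp.409–410 + Cor. 3.8 (3.94) p.410 + Cor. 3.6 p.408 + (3.42)–(3.47) pp.397–398; Balaban1984PropagatorsII, Lemma 2.1 (2.59)–(2.61) pp.233–234] -/
theorem thm37_cor38_complete_geo9Y {X Y ι PX PY : MemberY d ℓ hd hL b₀ b₁ Mstar → Type} [∀ x, Fintype (X x)]
    [∀ x, DecidableEq (X x)] [∀ x, Fintype (Y x)] [∀ x, DecidableEq (Y x)] [∀ x, Fintype (ι x)] [∀ x, Fintype (PX x)]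
    [∀ x, DecidableEq (PX x)] [∀ x, Fintype (PY x)] [∀ x, DecidableEq (PY x)]
    (𝔬 : ∀ x : MemberY d ℓ hd hL b₀ b₁ Mstar, Ops (geo9Y x) (bg x) (X x) (Y x) (ι x))
    (rd : ∀ x : MemberY d ℓ hd hL b₀ b₁ Mstar, WalkReading (geo9Y x) (bg x) (X x) (ι x))
    (H : MemberY d ℓ hd hL b₀ b₁ Mstar → Prop)
    (𝔭 : ∀ x : MemberY d ℓ hd hL b₀ b₁ Mstar, HolderProbes (geo9Y x) (bg x) (X x) (Y x) (PX x) (PY x))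
    (bH : ∀ x : MemberY d ℓ hd hL b₀ b₁ Mstar, ℝ → BlockNorm (toB6 (geo9Y x) 1 (H x)) (Y x → ℝ))
    (K : ∀ x : MemberY d ℓ hd hL b₀ b₁ Mstar, B9.KernelFamily (geo9Y x) (bg x))
    (ev : ∀ x : MemberY d ℓ hd hL b₀ b₁ Mstar, (geo9Y x).Loc → X x → ℝ)
    (evY : ∀ x : MemberY d ℓ hd hL b₀ b₁ Mstar, (geo9Y x).Loc → Y x → ℝ)
    (κ : MemberY d ℓ hd hL b₀ b₁ Mstar → Sizes) (SH SL SI S2 : ∀ x : MemberY d ℓ hd hL b₀ b₁ Mstar, ι x → Finset (geo9Y x).Site)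
    (Bl BV BI θI : ℝ → ℝ) (BI2 : ℝ → ℝ → ℝ)
    (α ρ N N' Cℓ Kc θ₀ B₀ δ₀ a₁ M₁ αF NH NL BL NI N2 B2 θ2 : ℝ) {B₁ δ₁ : ℝ} {Bβ Bε : ℝ → ℝ} {Bεβ : ℝ → ℝ → ℝ}
    (hc : 0 < c35) (hα : 0 < α) (hα2 : α < 1 / 2) (hN : 0 ≤ N) (hN' : 0 ≤ N') (hCℓ : 1 ≤ Cℓ) (hK : 0 ≤ Kc) (hθ₀ : 0 ≤ θ₀)
    (hB₀ : 0 < B₀) (hδ₀ : 0 < δ₀) (ha₁ : 0 < a₁) (hM₁ : 0 < M₁) (hαF : 0 < αF) (hαF2 : αF ≤ 1 / 2) (hNH : 0 ≤ NH)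
    (hNL : 0 ≤ NL) (hBL : 0 ≤ BL) (hNI : 0 ≤ NI) (hN2 : 0 ≤ N2) (hB2 : 0 ≤ B2) (hθ2 : 0 ≤ θ2)
    (hst : ∀ x, StaticOK (𝔬 x) ρ N N' Cℓ (κ x)) (hκ : ∀ x, (κ x).Bounded Kc θ₀ Cℓ (geo9Y x).M)
    (hrd : ∀ x, (rd x).OK (𝔬 x).blk) (hloc : ∀ x, Locality (𝔬 x) (rd x))
    (h36 : ∀ x, M₁ ≤ (geo9Y x).M → ∀ α₀ : ℝ, 0 < α₀ → c35 * (geo9Y x).M * α₀ ≤ a₁ →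
      ∀ U : (bg x).Cfg, (bg x).Reg335 c35 α₀ U → Local342 (𝔬 x) 1 (H x) B₀ δ₀ U ∧ Identities (𝔬 x) 1 (H x) U)
    (h36H : ∀ x, M₁ ≤ (geo9Y x).M → ∀ α₀ : ℝ, 0 < α₀ → c35 * (geo9Y x).M * α₀ ≤ a₁ →
      ∀ U : (bg x).Cfg, (bg x).Reg335 c35 α₀ U →
        HolderLegs37 (𝔬 x) (𝔭 x) 1 (H x) (SH x) Bl δ₀ U ∧ HolderV37 (𝔬 x) (𝔭 x) 1 (H x) BV δ₀ U ∧
          LapLegs37 (𝔬 x) 1 (H x) (SL x) BL δ₀ U ∧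
            InputLegs37 (𝔬 x) (𝔭 x) 1 (H x) (bH x) (SI x) BI BI2 δ₀ U ∧ FactorsInput37 (𝔬 x) 1 (H x) (bH x) θI δ₀ U ∧
              L2TwoLegs37 (𝔬 x) 1 (H x) (S2 x) B2 δ₀ U ∧ FactorsL2_37 (𝔬 x) 1 (H x) θ2 δ₀ U)
    (hco0 : ∀ x U, CoRealizes (K x) 0 U (𝔬 x).blk (𝔬 x).blk (ev x) ((𝔬 x).Gp U))
    (hco1 : ∀ x U, CoRealizes (K x) 1 U (𝔬 x).blkY (𝔬 x).blk (ev x) ((𝔬 x).D U ∘ₗ (𝔬 x).Gp U))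
    (hco2 : ∀ x U, CoRealizes (K x) 2 U (𝔬 x).blk (𝔬 x).blkY (evY x) ((𝔬 x).Gp U ∘ₗ (𝔬 x).Dstar U))
    (hco3 : ∀ x U, CoRealizes (K x) 3 U (𝔬 x).blk (𝔬 x).blk (ev x) ((𝔬 x).Lap U ∘ₗ (𝔬 x).Gp U))
    (hgl0 : ∀ x U, GlobReads (K x) 0 U (𝔬 x).blk (𝔬 x).blk (ev x) ((𝔬 x).Gp U))
    (hgl1 : ∀ x U, GlobReads (K x) 1 U (𝔬 x).blkY (𝔬 x).blk (ev x) ((𝔬 x).D U ∘ₗ (𝔬 x).Gp U))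
    (hgl2 : ∀ x U, GlobReads (K x) 2 U (𝔬 x).blk (𝔬 x).blkY (evY x) ((𝔬 x).Gp U ∘ₗ (𝔬 x).Dstar U))
    (hgl3 : ∀ x U, GlobReads (K x) 3 U (𝔬 x).blk (𝔬 x).blk (ev x) ((𝔬 x).Lap U ∘ₗ (𝔬 x).Gp U))
    (hl0 : ∀ x U, L2Reads (R := 1) (H := H x) (K x) 0 U (𝔬 x).blk (𝔬 x).blk (ev x) ((𝔬 x).Gp U))
    (hl1 : ∀ x U, L2Reads (R := 1) (H := H x) (K x) 1 U (𝔬 x).blkY (𝔬 x).blk (ev x) ((𝔬 x).D U ∘ₗ (𝔬 x).Gp U))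
    (hl2 : ∀ x U, L2Reads (R := 1) (H := H x) (K x) 2 U (𝔬 x).blk (𝔬 x).blkY (evY x) ((𝔬 x).Gp U ∘ₗ (𝔬 x).Dstar U))
    (hl3 : ∀ x U, L2Reads (R := 1) (H := H x) (K x) 3 U (𝔬 x).blk (𝔬 x).blk (ev x) ((𝔬 x).Lap U ∘ₗ (𝔬 x).Gp U))
    (hl4 : ∀ x U, L2Reads (R := 1) (H := H x) (K x) 4 U (𝔬 x).blkY (𝔬 x).blkY (evY x)
      ((𝔬 x).D U ∘ₗ ((𝔬 x).Gp U ∘ₗ (𝔬 x).Dstar U)))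
    (hl5 : ∀ x U, L2Reads (R := 1) (H := H x) (K x) 5 U (𝔬 x).blk (𝔬 x).blk (ev x) ((𝔬 x).Gp U ∘ₗ (𝔬 x).Lap U))
    (hH1 : ∀ x U, H1Reads (K x) U (𝔭 x) (𝔬 x).blk (𝔬 x).blkY (ev x) (evY x) ((𝔬 x).D U ∘ₗ (𝔬 x).Gp U)
      ((𝔬 x).Gp U ∘ₗ (𝔬 x).Dstar U))
    (hIR : ∀ x U, InputReads (K x) U (𝔭 x) (bH x) (𝔬 x).blkY (evY x) ((𝔬 x).D U ∘ₗ ((𝔬 x).Gp U ∘ₗ (𝔬 x).Dstar U)))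
    (hsym : ∀ x U, IsTransposePair ((𝔬 x).Gp U) ((𝔬 x).Gp U))
    (htr : ∀ x U, IsTransposePair ((𝔬 x).D U ∘ₗ (𝔬 x).Gp U) ((𝔬 x).Gp U ∘ₗ (𝔬 x).Dstar U))
    (hadjL : ∀ x U, IsTransposePair ((𝔬 x).Lap U ∘ₗ (𝔬 x).Gp U) ((𝔬 x).Gp U ∘ₗ (𝔬 x).Lap U))
    (hcntH : ∀ x (a : (geo9Y x).Site), (∑ q, if a ∈ SH x q then (1 : ℝ) else 0) ≤ NH)
    (hcntL : ∀ x (a : (geo9Y x).Site), (∑ q, if a ∈ SL x q then (1 : ℝ) else 0) ≤ NL)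
    (hcntI : ∀ x (a : (geo9Y x).Site), (∑ q, if a ∈ SI x q then (1 : ℝ) else 0) ≤ NI)
    (hcnt2 : ∀ x (a : (geo9Y x).Site), (∑ q, if a ∈ S2 x q then (1 : ℝ) else 0) ≤ N2)
    (hBl : ∀ β, 0 ≤ β → β < 1 → 0 ≤ Bl β) (hBV : ∀ β, 0 ≤ β → β < 1 → 0 ≤ BV β)
    (hBI : ∀ ε, 0 < ε → ε ≤ 1 → 0 ≤ BI ε) (hBI2 : ∀ ε β, 0 < ε → ε ≤ 1 → 0 ≤ β → β < 1 → 0 ≤ BI2 ε β)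
    (hθI : ∀ ε, 0 < ε → 0 ≤ θI ε)
    -- the relations of the all-blocks constants (B₁, δ₁, Bβ, Bε, Bεβ) to the definite derived ones
    (hCB : const37 (exp261 (@geo9Y d ℓ hd hL b₀ b₁ Mstar) δ₀ α) δ₀ α ρ B₀ N N' Cℓ Kc ≤ B₁)
    (hCL : const37 (exp261 (@geo9Y d ℓ hd hL b₀ b₁ Mstar) δ₀ α) δ₀ α ρ B₀ N N' Cℓ Kc * ((ℓ + 1 : ℕ) : ℝ) ≤ B₁)
    (hδ₁ : δ₁ ≤ (1 - 2 * αF) * ((1 - 2 * α) * δ₀))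
    (hCg : const37 (exp261 (@geo9Y d ℓ hd hL b₀ b₁ Mstar) δ₀ α) δ₀ α ρ B₀ N N' Cℓ Kc *
      B6.c1 (exp261 (@geo9Y d ℓ hd hL b₀ b₁ Mstar) ((1 - 2 * α) * δ₀) (1 - αF)) ((1 - 2 * α) * δ₀) (1 - αF) *
        ((ℓ + 1 : ℕ) : ℝ) ^ (4 : ℝ) ≤ B₁)
    (hB5 : Real.sqrt (const37 (exp261 (@geo9Y d ℓ hd hL b₀ b₁ Mstar) δ₀ α) δ₀ α ρ B₀ N N' Cℓ Kc *
      lapConst (exp261 (@geo9Y d ℓ hd hL b₀ b₁ Mstar) δ₀ α) δ₀ α NL BL ((ℓ + 1 : ℕ) : ℝ)) * ((ℓ + 1 : ℕ) : ℝ) ≤ B₁)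
    (hB4 : twoConst (exp261 (@geo9Y d ℓ hd hL b₀ b₁ Mstar) δ₀ α) δ₀ α N2 B2 N' θ2
      (const37 (exp261 (@geo9Y d ℓ hd hL b₀ b₁ Mstar) δ₀ α) δ₀ α ρ B₀ N N' Cℓ Kc) ((ℓ + 1 : ℕ) : ℝ) ≤ B₁)
    (hBβ : ∀ β, 0 ≤ β → β < 1 →
      holderConst (exp261 (@geo9Y d ℓ hd hL b₀ b₁ Mstar) δ₀ α) δ₀ α NH N'
        (const37 (exp261 (@geo9Y d ℓ hd hL b₀ b₁ Mstar) δ₀ α) δ₀ α ρ B₀ N N' Cℓ Kc) (Bl β) (BV β) ≤ Bβ β)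
    (hBε : ∀ ε, 0 < ε → ε ≤ 1 →
      inputConst44 (exp261 (@geo9Y d ℓ hd hL b₀ b₁ Mstar) δ₀ α) δ₀ α NI N'
        (const37 (exp261 (@geo9Y d ℓ hd hL b₀ b₁ Mstar) δ₀ α) δ₀ α ρ B₀ N N' Cℓ Kc) ((ℓ + 1 : ℕ) : ℝ) (BI ε) (θI ε) ≤ Bε ε)
    (hBεβ : ∀ ε β, 0 < ε → ε ≤ 1 → 0 ≤ β → β < 1 →
      inputConst45 (exp261 (@geo9Y d ℓ hd hL b₀ b₁ Mstar) δ₀ α) δ₀ α NI N' ((ℓ + 1 : ℕ) : ℝ)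
        (holderConst (exp261 (@geo9Y d ℓ hd hL b₀ b₁ Mstar) δ₀ α) δ₀ α NH N'
          (const37 (exp261 (@geo9Y d ℓ hd hL b₀ b₁ Mstar) δ₀ α) δ₀ α ρ B₀ N N' Cℓ Kc) (Bl β) (BV β))
        (BI2 ε β) (θI (β + ε)) ≤ Bεβ ε β) :
    B9.Thm37Printed c35 geo9Y bg
        (fun x => E37AllOfOps
          (W38OfOps (𝔬 x) (rd x) 1 (H x) (const37 (exp261 (@geo9Y d ℓ hd hL b₀ b₁ Mstar) δ₀ α) δ₀ α ρ B₀ N N' Cℓ Kc)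
            ((1 - 2 * α) * δ₀))
          (𝔬 x) 1 (H x) (const37 (exp261 (@geo9Y d ℓ hd hL b₀ b₁ Mstar) δ₀ α) δ₀ α ρ B₀ N N' Cℓ Kc) ((1 - 2 * α) * δ₀)
          (K x) B₁ δ₁ Bβ Bε Bεβ) ∧
      B9.Cor38Printed c35 geo9Y bg
        (fun x => E37AllOfOps
          (W38OfOps (𝔬 x) (rd x) 1 (H x) (const37 (exp261 (@geo9Y d ℓ hd hL b₀ b₁ Mstar) δ₀ α) δ₀ α ρ B₀ N N' Cℓ Kc)
            ((1 - 2 * α) * δ₀))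
          (𝔬 x) 1 (H x) (const37 (exp261 (@geo9Y d ℓ hd hL b₀ b₁ Mstar) δ₀ α) δ₀ α ρ B₀ N N' Cℓ Kc) ((1 - 2 * α) * δ₀)
          (K x) B₁ δ₁ Bβ Bε Bεβ) := by
  obtain ⟨Mth, h261, hfacts, hfacts₀⟩ :=
    lemma21Pack_geo9Y (d := d) (ℓ := ℓ) (hd := hd) (hL := hL) (b₀ := b₀) (b₁ := b₁) (Mstar := Mstar) H hα hα2 hδ₀ hαF
      (by linarith)
  obtain ⟨h37, hc38⟩ := thm37_cor38_W38OfOps_exp261_geo9Y (bg := bg) 𝔬 rd (fun _ => 1) H κ α ρ N N' Cℓ Kc θ₀ B₀ δ₀ a₁ M₁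
    hc hα hα2.le hN hN' hCℓ hK hθ₀ hB₀ hδ₀ ha₁ hM₁ hst hκ hrd hloc h36
  have hC : 0 ≤ const37 (exp261 (@geo9Y d ℓ hd hL b₀ b₁ Mstar) δ₀ α) δ₀ α ρ B₀ N N' Cℓ Kc :=
    const37_nonneg_of_signs _ hB₀.le hN hN' (zero_le_one.trans hCℓ) hK
  have hδs : 0 < (1 - 2 * α) * δ₀ := mul_pos (by linarith) hδ₀
  refine ⟨?_, (cor38Printed_E37AllOfOps_iff _ 𝔬 (fun _ => 1) H _ _ K B₁ δ₁ Bβ Bε Bεβ).mpr hc38⟩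
  exact thm37Printed_allPin_complete (geo := geo9Y) (R := fun _ => (1 : ℝ)) 𝔭 bH K ev evY κ SH Bl BV
    (exp261 (@geo9Y d ℓ hd hL b₀ b₁ Mstar) δ₀ α) δ₀ α ρ N N' Cℓ Kc θ₀ B₀ NH a₁ M₁ Mth SL NL BL Mth
    (exp261 (@geo9Y d ℓ hd hL b₀ b₁ Mstar) δ₀ (1 - α)) SI NI BI θI BI2 S2 N2 B2 θ2 h37 hco0 hco1 hco2 hco3 hgl0 hgl1 hgl2 hgl3
    hl0 hl1 hl2 hl3 hl4 hl5 hH1 hIR hsym htr hadjL hfacts geo9Y_dist_symm hC hCB hCL (by nlinarith) hδ₁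
    (mul_nonneg hαF.le hδs.le) (by nlinarith) hCg hc ha₁ hα.le hα2.le hN' (zero_le_one.trans hCℓ) hB₀.le hNH hM₁ hδs.le le_rfl
    hδ₀.le hNL hBL hNI hN2 hB2 hθ2 hB5 hB4 hst hκ hcntH hcntL hcntI hcnt2 hBl hBV hBI hBI2 hθI hBβ hBε hBεβ h261 hfacts₀
    (fun x hM α₀ hα₀ ha U hU => ⟨(h36 x hM α₀ hα₀ ha U hU).1, (h36 x hM α₀ hα₀ ha U hU).2, (h36H x hM α₀ hα₀ ha U hU).1,
      (h36H x hM α₀ hα₀ ha U hU).2.1⟩)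
    (fun x hM α₀ hα₀ ha U hU => (h36H x hM α₀ hα₀ ha U hU).2.2.1)
    (fun x hM α₀ hα₀ ha U hU => ⟨(h36H x hM α₀ hα₀ ha U hU).2.2.2.1, (h36H x hM α₀ hα₀ ha U hU).2.2.2.2.1⟩)
    (fun x hM α₀ hα₀ ha U hU => (h36H x hM α₀ hα₀ ha U hU).2.2.2.2.2)

/-! ## Rows 18 ∕ 19, G side: Theorem 3.10 at the literal all-blocks pin over the geometry of record -/

/-- ★★ **THEOREM 3.10 AT THE LITERAL ALL-BLOCKS PIN OVER def-Y's MEMBERS, FROM OPERATOR-LEVEL INPUTS ONLY.**  With `C := const37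
(exp261 geo9Y δ₀ α) δ₀ α ρ B₀ N N′ C_ℓ K_c`, `δ := (1 − 2α)δ₀` and the pin `W310OfOps (𝔬 x) (rd x) (ConvAll3107 (𝔬 x) 1 (H x) C δ (K x)
B₁ δ₁ Bβ Bε Bεβ)` (p. 416: *"From (3.108) it follows that the expansion (3.107) is convergent in all norms in the inequalities
(3.42)–(3.47). This implies Theorem 3.3."* READ as Theorem 3.3's typed blocks for `K x`): the leaf `B9.Thm310Printed` holds, given
— the static data (`StaticOK310`, `Sizes310.Bounded`, `WalkReading310.OK`, `Locality310`); Corollary 3.6's blocks for the G_□, (3.89)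
and the structure (3.105) (`h36`), the Hölder ∕ probe-factor ∕ Laplacian ∕ input ∕ two-sided L² legs (`h36H`) at
(B₀, δ₀), all POSITED for M ≧ M₁, 0 < α₀, O(1)Mα₀ ≦ a₁, (3.35); the co-readings of `K x`; the transpose letters; the support
counts; the signs; the relations of (B₁, δ₁, Bβ, Bε, Bεβ) to the derived constants.  [4] Lemma 2.1, 1 ≦ L ≦ ℓ + 1, η > 0 and the
symmetry of d come from the record (`lemma21Pack_geo9Y`, `geo9Y_dist_symm`), the sup-block leaf from `thm310Printed_exp261_geo9Y`,
the rest is `B9RWSums346Two.thm310Printed_allPin_complete`.  Nothing of print asserted; NOT a node discharge.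
[cite: Balaban1985BackgroundPropagators, Thm 3.10 (3.105)–(3.108) pp.413–416 + Thm 3.3 p.399 + Cor. 3.6 p.408 + (3.42)–(3.47) pp.397–398; Balaban1984PropagatorsII, Lemma 2.1 (2.59)–(2.61) pp.233–234] -/
theorem thm310_complete_geo9Y {X Y ι A PX PY : MemberY d ℓ hd hL b₀ b₁ Mstar → Type} [∀ x, Fintype (X x)]
    [∀ x, DecidableEq (X x)] [∀ x, Fintype (Y x)] [∀ x, DecidableEq (Y x)] [∀ x, Fintype (ι x)] [∀ x, Fintype (A x)]
    [∀ x, Fintype (PX x)] [∀ x, DecidableEq (PX x)] [∀ x, Fintype (PY x)] [∀ x, DecidableEq (PY x)]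
    (𝔬 : ∀ x : MemberY d ℓ hd hL b₀ b₁ Mstar, Ops310 (geo9Y x) (bg x) (X x) (Y x) (ι x) (A x))
    (rd : ∀ x : MemberY d ℓ hd hL b₀ b₁ Mstar, WalkReading310 (geo9Y x) (bg x) (X x) (ι x) (A x))
    (H : MemberY d ℓ hd hL b₀ b₁ Mstar → Prop)
    (𝔭 : ∀ x : MemberY d ℓ hd hL b₀ b₁ Mstar, HolderProbes (geo9Y x) (bg x) (X x) (Y x) (PX x) (PY x))
    (bH : ∀ x : MemberY d ℓ hd hL b₀ b₁ Mstar, ℝ → BlockNorm (toB6 (geo9Y x) 1 (H x)) (Y x → ℝ))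
    (K : ∀ x : MemberY d ℓ hd hL b₀ b₁ Mstar, B9.KernelFamily (geo9Y x) (bg x))
    (ev : ∀ x : MemberY d ℓ hd hL b₀ b₁ Mstar, (geo9Y x).Loc → X x → ℝ)
    (evY : ∀ x : MemberY d ℓ hd hL b₀ b₁ Mstar, (geo9Y x).Loc → Y x → ℝ)
    (κ : MemberY d ℓ hd hL b₀ b₁ Mstar → Sizes310)
    (SH SL SI S2 : ∀ x : MemberY d ℓ hd hL b₀ b₁ Mstar, ι x → Finset (geo9Y x).Site)
    (Bl θH BI θI : ℝ → ℝ) (BI2 : ℝ → ℝ → ℝ)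
    (α ρ N N' NF Cℓ Kc θ₀ B₀ δ₀ a₁ M₁ αF NH NL BL NI N2 B2 θ2 : ℝ) {B₁ δ₁ : ℝ} {Bβ Bε : ℝ → ℝ} {Bεβ : ℝ → ℝ → ℝ}
    (hc : 0 < c35) (hα : 0 < α) (hα2 : α < 1 / 2) (hN : 0 ≤ N) (hN' : 0 ≤ N') (hNF : 0 ≤ NF) (hCℓ : 1 ≤ Cℓ) (hK : 0 ≤ Kc)
    (hθ₀ : 0 ≤ θ₀) (hB₀ : 0 < B₀) (hδ₀ : 0 < δ₀) (ha₁ : 0 < a₁) (hM₁ : 0 < M₁) (hαF : 0 < αF) (hαF2 : αF ≤ 1 / 2)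
    (hNH : 0 ≤ NH) (hNL : 0 ≤ NL) (hBL : 0 ≤ BL) (hNI : 0 ≤ NI) (hN2 : 0 ≤ N2) (hB2 : 0 ≤ B2) (hθ2 : 0 ≤ θ2)
    (hst : ∀ x, StaticOK310 (𝔬 x) ρ N N' NF Cℓ (κ x)) (hκ : ∀ x, (κ x).Bounded Kc)
    (hrd : ∀ x, (rd x).OK (𝔬 x).blk) (hloc : ∀ x, Locality310 (𝔬 x) (rd x))
    (h36 : ∀ x, M₁ ≤ (geo9Y x).M → ∀ α₀ : ℝ, 0 < α₀ → c35 * (geo9Y x).M * α₀ ≤ a₁ →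
      ∀ U : (bg x).Cfg, (bg x).Reg335 c35 α₀ U →
        Local342G (𝔬 x) 1 (H x) B₀ δ₀ U ∧ B9Thm310Whole.Factors389 (𝔬 x) 1 (H x) θ₀ δ₀ U ∧ Identities310 (𝔬 x) 1 (H x) U)
    (h36H : ∀ x, M₁ ≤ (geo9Y x).M → ∀ α₀ : ℝ, 0 < α₀ → c35 * (geo9Y x).M * α₀ ≤ a₁ →
      ∀ U : (bg x).Cfg, (bg x).Reg335 c35 α₀ U →
        HolderLegs310 (𝔬 x) (𝔭 x) 1 (H x) (SH x) Bl δ₀ U ∧ FactorsHolder310 (𝔬 x) (𝔭 x) 1 (H x) θH δ₀ U ∧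
          LapLegs310 (𝔬 x) 1 (H x) (SL x) BL δ₀ U ∧
            InputLegs310 (𝔬 x) (𝔭 x) 1 (H x) (bH x) (SI x) BI BI2 δ₀ U ∧ FactorsInput310 (𝔬 x) 1 (H x) (bH x) θI δ₀ U ∧
              L2TwoLegs310 (𝔬 x) 1 (H x) (S2 x) B2 δ₀ U ∧ FactorsL2_310 (𝔬 x) 1 (H x) θ2 δ₀ U)
    (hco0 : ∀ x U, CoRealizes (K x) 0 U (𝔬 x).blk (𝔬 x).blk (ev x) ((𝔬 x).G U))
    (hco1 : ∀ x U, CoRealizes (K x) 1 U (𝔬 x).blkY (𝔬 x).blk (ev x) ((𝔬 x).D U ∘ₗ (𝔬 x).G U))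
    (hco2 : ∀ x U, CoRealizes (K x) 2 U (𝔬 x).blk (𝔬 x).blkY (evY x) ((𝔬 x).G U ∘ₗ (𝔬 x).Dstar U))
    (hco3 : ∀ x U, CoRealizes (K x) 3 U (𝔬 x).blk (𝔬 x).blk (ev x) ((𝔬 x).Lap U ∘ₗ (𝔬 x).G U))
    (hgl0 : ∀ x U, GlobReads (K x) 0 U (𝔬 x).blk (𝔬 x).blk (ev x) ((𝔬 x).G U))
    (hgl1 : ∀ x U, GlobReads (K x) 1 U (𝔬 x).blkY (𝔬 x).blk (ev x) ((𝔬 x).D U ∘ₗ (𝔬 x).G U))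
    (hgl2 : ∀ x U, GlobReads (K x) 2 U (𝔬 x).blk (𝔬 x).blkY (evY x) ((𝔬 x).G U ∘ₗ (𝔬 x).Dstar U))
    (hgl3 : ∀ x U, GlobReads (K x) 3 U (𝔬 x).blk (𝔬 x).blk (ev x) ((𝔬 x).Lap U ∘ₗ (𝔬 x).G U))
    (hl0 : ∀ x U, L2Reads (R := 1) (H := H x) (K x) 0 U (𝔬 x).blk (𝔬 x).blk (ev x) ((𝔬 x).G U))
    (hl1 : ∀ x U, L2Reads (R := 1) (H := H x) (K x) 1 U (𝔬 x).blkY (𝔬 x).blk (ev x) ((𝔬 x).D U ∘ₗ (𝔬 x).G U))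
    (hl2 : ∀ x U, L2Reads (R := 1) (H := H x) (K x) 2 U (𝔬 x).blk (𝔬 x).blkY (evY x) ((𝔬 x).G U ∘ₗ (𝔬 x).Dstar U))
    (hl3 : ∀ x U, L2Reads (R := 1) (H := H x) (K x) 3 U (𝔬 x).blk (𝔬 x).blk (ev x) ((𝔬 x).Lap U ∘ₗ (𝔬 x).G U))
    (hl4 : ∀ x U, L2Reads (R := 1) (H := H x) (K x) 4 U (𝔬 x).blkY (𝔬 x).blkY (evY x)
      ((𝔬 x).D U ∘ₗ ((𝔬 x).G U ∘ₗ (𝔬 x).Dstar U)))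
    (hl5 : ∀ x U, L2Reads (R := 1) (H := H x) (K x) 5 U (𝔬 x).blk (𝔬 x).blk (ev x) ((𝔬 x).G U ∘ₗ (𝔬 x).Lap U))
    (hH1 : ∀ x U, H1Reads (K x) U (𝔭 x) (𝔬 x).blk (𝔬 x).blkY (ev x) (evY x) ((𝔬 x).D U ∘ₗ (𝔬 x).G U)
      ((𝔬 x).G U ∘ₗ (𝔬 x).Dstar U))
    (hIR : ∀ x U, InputReads (K x) U (𝔭 x) (bH x) (𝔬 x).blkY (evY x) ((𝔬 x).D U ∘ₗ ((𝔬 x).G U ∘ₗ (𝔬 x).Dstar U)))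
    (hsym : ∀ x U, IsTransposePair ((𝔬 x).G U) ((𝔬 x).G U))
    (htr : ∀ x U, IsTransposePair ((𝔬 x).D U ∘ₗ (𝔬 x).G U) ((𝔬 x).G U ∘ₗ (𝔬 x).Dstar U))
    (hadjL : ∀ x U, IsTransposePair ((𝔬 x).Lap U ∘ₗ (𝔬 x).G U) ((𝔬 x).G U ∘ₗ (𝔬 x).Lap U))
    (hcntH : ∀ x (a : (geo9Y x).Site), (∑ q, if a ∈ SH x q then (1 : ℝ) else 0) ≤ NH)
    (hcntL : ∀ x (a : (geo9Y x).Site), (∑ q, if a ∈ SL x q then (1 : ℝ) else 0) ≤ NL)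
    (hcntI : ∀ x (a : (geo9Y x).Site), (∑ q, if a ∈ SI x q then (1 : ℝ) else 0) ≤ NI)
    (hcnt2 : ∀ x (a : (geo9Y x).Site), (∑ q, if a ∈ S2 x q then (1 : ℝ) else 0) ≤ N2)
    (hBl : ∀ β, 0 ≤ β → β < 1 → 0 ≤ Bl β) (hθH : ∀ β, 0 ≤ β → β < 1 → 0 ≤ θH β)
    (hBI : ∀ ε, 0 < ε → ε ≤ 1 → 0 ≤ BI ε) (hBI2 : ∀ ε β, 0 < ε → ε ≤ 1 → 0 ≤ β → β < 1 → 0 ≤ BI2 ε β)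
    (hθI : ∀ ε, 0 < ε → 0 ≤ θI ε)
    -- the relations of the all-blocks constants (B₁, δ₁, Bβ, Bε, Bεβ) to the definite derived ones
    (hCB : const37 (exp261 (@geo9Y d ℓ hd hL b₀ b₁ Mstar) δ₀ α) δ₀ α ρ B₀ N N' Cℓ Kc ≤ B₁)
    (hCL : const37 (exp261 (@geo9Y d ℓ hd hL b₀ b₁ Mstar) δ₀ α) δ₀ α ρ B₀ N N' Cℓ Kc * ((ℓ + 1 : ℕ) : ℝ) ≤ B₁)
    (hδ₁ : δ₁ ≤ (1 - 2 * αF) * ((1 - 2 * α) * δ₀))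
    (hCg : const37 (exp261 (@geo9Y d ℓ hd hL b₀ b₁ Mstar) δ₀ α) δ₀ α ρ B₀ N N' Cℓ Kc *
      B6.c1 (exp261 (@geo9Y d ℓ hd hL b₀ b₁ Mstar) ((1 - 2 * α) * δ₀) (1 - αF)) ((1 - 2 * α) * δ₀) (1 - αF) *
        ((ℓ + 1 : ℕ) : ℝ) ^ (4 : ℝ) ≤ B₁)
    (hB5 : Real.sqrt (const37 (exp261 (@geo9Y d ℓ hd hL b₀ b₁ Mstar) δ₀ α) δ₀ α ρ B₀ N N' Cℓ Kc *
      lapConst (exp261 (@geo9Y d ℓ hd hL b₀ b₁ Mstar) δ₀ α) δ₀ α NL BL ((ℓ + 1 : ℕ) : ℝ)) * ((ℓ + 1 : ℕ) : ℝ) ≤ B₁)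
    (hB4 : twoConst (exp261 (@geo9Y d ℓ hd hL b₀ b₁ Mstar) δ₀ α) δ₀ α N2 B2 NF θ2
      (const37 (exp261 (@geo9Y d ℓ hd hL b₀ b₁ Mstar) δ₀ α) δ₀ α ρ B₀ N N' Cℓ Kc) ((ℓ + 1 : ℕ) : ℝ) ≤ B₁)
    (hBβ : ∀ β, 0 ≤ β → β < 1 →
      holderConst (exp261 (@geo9Y d ℓ hd hL b₀ b₁ Mstar) δ₀ α) δ₀ α NH NF
        (const37 (exp261 (@geo9Y d ℓ hd hL b₀ b₁ Mstar) δ₀ α) δ₀ α ρ B₀ N N' Cℓ Kc) (Bl β) (θH β) ≤ Bβ β)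
    (hBε : ∀ ε, 0 < ε → ε ≤ 1 →
      inputConst44 (exp261 (@geo9Y d ℓ hd hL b₀ b₁ Mstar) δ₀ α) δ₀ α NI NF
        (const37 (exp261 (@geo9Y d ℓ hd hL b₀ b₁ Mstar) δ₀ α) δ₀ α ρ B₀ N N' Cℓ Kc) ((ℓ + 1 : ℕ) : ℝ) (BI ε) (θI ε) ≤ Bε ε)
    (hBεβ : ∀ ε β, 0 < ε → ε ≤ 1 → 0 ≤ β → β < 1 →
      inputConst45 (exp261 (@geo9Y d ℓ hd hL b₀ b₁ Mstar) δ₀ α) δ₀ α NI NF ((ℓ + 1 : ℕ) : ℝ)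
        (holderConst (exp261 (@geo9Y d ℓ hd hL b₀ b₁ Mstar) δ₀ α) δ₀ α NH NF
          (const37 (exp261 (@geo9Y d ℓ hd hL b₀ b₁ Mstar) δ₀ α) δ₀ α ρ B₀ N N' Cℓ Kc) (Bl β) (θH β))
        (BI2 ε β) (θI (β + ε)) ≤ Bεβ ε β) :
    B9.Thm310Printed c35 geo9Y bg
      (fun x => W310OfOps (𝔬 x) (rd x)
        (ConvAll3107 (𝔬 x) 1 (H x) (const37 (exp261 (@geo9Y d ℓ hd hL b₀ b₁ Mstar) δ₀ α) δ₀ α ρ B₀ N N' Cℓ Kc)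
          ((1 - 2 * α) * δ₀) (K x) B₁ δ₁ Bβ Bε Bεβ)) := by
  obtain ⟨Mth, h261, hfacts, hfacts₀⟩ :=
    lemma21Pack_geo9Y (d := d) (ℓ := ℓ) (hd := hd) (hL := hL) (b₀ := b₀) (b₁ := b₁) (Mstar := Mstar) H hα hα2 hδ₀ hαF
      (by linarith)
  have h310 := thm310Printed_exp261_geo9Y (bg := bg) 𝔬 rd (fun _ => 1) H κ α ρ N N' NF Cℓ Kc θ₀ B₀ δ₀ a₁ M₁ hc hα hα2.le hN
    hN' hNF hCℓ hK hθ₀ hB₀ hδ₀ ha₁ hM₁ hst hκ hrd hloc h36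
  have hC : 0 ≤ const37 (exp261 (@geo9Y d ℓ hd hL b₀ b₁ Mstar) δ₀ α) δ₀ α ρ B₀ N N' Cℓ Kc :=
    const37_nonneg_of_signs _ hB₀.le hN hN' (zero_le_one.trans hCℓ) hK
  have hδs : 0 < (1 - 2 * α) * δ₀ := mul_pos (by linarith) hδ₀
  exact thm310Printed_allPin_complete (geo := geo9Y) (R := fun _ => (1 : ℝ)) 𝔭 bH K ev evY κ SH Bl θH
    (exp261 (@geo9Y d ℓ hd hL b₀ b₁ Mstar) δ₀ α) δ₀ α ρ N N' NF Cℓ θ₀ NH a₁ M₁ Mth SL NL BL Mth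
    (exp261 (@geo9Y d ℓ hd hL b₀ b₁ Mstar) δ₀ (1 - α)) SI NI BI θI BI2 S2 N2 B2 θ2 h310 hco0 hco1 hco2 hco3 hgl0 hgl1 hgl2 hgl3
    hl0 hl1 hl2 hl3 hl4 hl5 hH1 hIR hsym htr hadjL hfacts geo9Y_dist_symm hC hCB hCL (by nlinarith) hδ₁
    (mul_nonneg hαF.le hδs.le) (by nlinarith) hCg hc ha₁ hα.le hα2.le hNF hθ₀ hNH hδs.le le_rfl hδ₀.le hNL hBL hNI hN2 hB2
    hθ2 hB5 hB4 hst hcntH hcntL hcntI hcnt2 hBl hθH hBI hBI2 hθI hBβ hBε hBεβ h261 hfacts₀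
    (fun x hM α₀ hα₀ ha U hU => ⟨(h36 x hM α₀ hα₀ ha U hU).2.1, (h36 x hM α₀ hα₀ ha U hU).2.2, (h36H x hM α₀ hα₀ ha U hU).1,
      (h36H x hM α₀ hα₀ ha U hU).2.1⟩)
    (fun x hM α₀ hα₀ ha U hU => (h36H x hM α₀ hα₀ ha U hU).2.2.1)
    (fun x hM α₀ hα₀ ha U hU => ⟨(h36H x hM α₀ hα₀ ha U hU).2.2.2.1, (h36H x hM α₀ hα₀ ha U hU).2.2.2.2.1⟩)
    (fun x hM α₀ hα₀ ha U hU => (h36H x hM α₀ hα₀ ha U hU).2.2.2.2.2)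

end Literature.MathematicalPhysics.QuantumFieldTheory.Balaban1983to89.B9RWSumsCompleteGeo9Y

end
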